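import HarnessLib
import Summits.RiemannHypothesis.RiemannHypothesis.Theorems.SignConeSignConeOscillatoryStatus

/-!
# `OscSingleWindow` (item stmt-RiemannHypothesis-18012): the CUTOFF REDUCTION — a bounded cutoff needs
only finitely many window slices (route `SignCone`; HELPER file `--supports`, closes nothing)

The support decl `Summit.RiemannHypothesis.RiemannHypothesis.Theses.SignCone.OscSingleWindow` is the
unit-slack sign-cone inequality `-Re F(0) ≤ Re W_ar(F)` for node-nonnegative autocorrelation sums
`F = Σᵢ gᵢ ⋆ g̃ᵢ` (`supp gᵢ ⊆ [-a, a]`) whose far-field negativity `{|t| ≥ log 2 : Re F(t) < 0}` is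
non-empty and confined to ONE window `T ≤ |t| ≤ T + log 2`, `T ≥ 3`; it quantifies over EVERY cutoff
`a > 0`, hence over every window height `T ≥ 3`. The landed line (`oscSingleWindowAt_of_erasure`,
`PWData.oscSingleWindowAt_of_checks`, the far-range checker) proves the body AT A WINDOW `T` from a
kernel-checked erasure certificate, one certificate per bounded `T`-slice (`oswCert305`: `3 ≤ T ≤ 61/20`,
`oswCert315`: `61/20 ≤ T ≤ 63/20`, …), while the tail `T → ∞` is the open residue (one-octave sup-norm
of `ζ(1/2+iτ)`-type sums; see the item's census). This file is the pure-logic glue that turns finitely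
many slices into the CUTOFF-BOUNDED form of the item:

* `singleWindow_lt_two_mul` — under the window and oscillation hypotheses the window height is BELOW
  the support bound: `T < 2a` (`F = 0` on `|t| ≥ 2a`, `autocorrSum_eq_zero_of_le`, while some far-field
  negativity point has `|t| ≥ T`);
* `oscSingleWindow_cutoff_of_slices` — if the body holds at every window `3 ≤ T < T₁` (every cutoff),
  then the route body (with its `∃ T ≥ 3` window hypothesis) holds at every cutoff `a` with `2a ≤ T₁`;
  `oscSingleWindow_upTo_of_slices` is the same with the bound written `a ≤ a₁` (slices `3 ≤ T < 2a₁`);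
* `oscSingleWindow_of_forall_window` / `forall_window_of_oscSingleWindow` — the item itself is
  EXACTLY "the body at every window `T ≥ 3`" (so the slices are the item restricted in `T`, nothing
  weaker and nothing stronger).

So a restated support `∀ a, 0 < a → a ≤ a₁ → …` (e.g. `a₁ = 2`: windows `3 ≤ T < 4`) is closed by
finitely many certificates of the landed format and `oscSingleWindow_upTo_of_slices`; no number theory
and no computation here.
-/

noncomputable section

-- `Summit.RiemannHypothesis.RiemannHypothesis.…` repeats a namespace component by design (D-0017 layout).
set_option linter.dupNamespace false

open scoped BigOperators ComplexConjugate
open Complex MeasureTheory Set Filter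

namespace Summit.RiemannHypothesis.RiemannHypothesis.Theorems.SignCone

open Literature.NumberTheory.LFunctions
open Summit.RiemannHypothesis.RiemannHypothesis.Theses.SignCone

variable {k : ℕ}

/-! ## The window sits below the support bound -/

/-- **`T < 2a`.** If the `gᵢ` are Weil tests supported in `[-a, a]` (`a > 0`), the far-field negativity of
`F = Σᵢ gᵢ ⋆ g̃ᵢ` is confined to the window `T ≤ |t| ≤ T + log 2`, and some far-field negativity exists,
then `T < 2a`: otherwise the negativity point `t` has `|t| ≥ T ≥ 2a`, where `F` vanishes
(`autocorrSum_eq_zero_of_le`). [folklore] -/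
theorem singleWindow_lt_two_mul {a : ℝ} (ha : 0 < a) (g : Fin k → ℝ → ℂ) (hg : ∀ i, IsWeilTest (g i))
    (hs : ∀ i, tsupport (g i) ⊆ Icc (-a) a) {T : ℝ}
    (hw : ∀ t : ℝ, Real.log 2 ≤ |t| →
      ((fun t => ∑ i, weilConv (g i) (weilReflect (g i)) t) t).re < 0 → T ≤ |t| ∧ |t| ≤ T + Real.log 2)
    (hosc : ∃ t : ℝ, Real.log 2 ≤ |t| ∧ ((fun t => ∑ i, weilConv (g i) (weilReflect (g i)) t) t).re < 0) :
    T < 2 * a := by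
  obtain ⟨t, ht, hneg⟩ := hosc
  have hTt : T ≤ |t| := (hw t ht hneg).1
  by_contra hle
  push Not at hle
  rw [autocorrSum_eq_zero_of_le ha g hg hs (hle.trans hTt), Complex.zero_re] at hneg
  exact lt_irrefl _ hneg

/-- The same over Mathlib primitives (the verbatim binders of the route decl): the window height of a
single-window oscillatory test at cutoff `a` is `< 2a`. [folklore] -/
theorem singleWindow_lt_two_mul' :
    ∀ a : ℝ, 0 < a → ∀ (k : ℕ) (g : Fin k → ℝ → ℂ), (∀ i, (ContDiff ℝ ((⊤ : ℕ∞) : WithTop ℕ∞) (g i) ∧ HasCompactSupport (g i)) ∧ tsupport (g i) ⊆ Set.Icc (-a) a) → let F : ℝ → ℂ := fun t => ∑ i, MeasureTheory.convolution (g i) (fun u => (starRingEnd ℂ) ((g i) (-u))) (ContinuousLinearMap.mul ℂ ℂ) MeasureTheory.MeasureSpace.volume t; ∀ T : ℝ, (∀ t : ℝ, Real.log 2 ≤ |t| → (F t).re < 0 → T ≤ |t| ∧ |t| ≤ T + Real.log 2) → (∃ t : ℝ, Real.log 2 ≤ |t| ∧ (F t).re < 0) → T < 2 * a :=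
  fun _ ha _ g hg _ hw hosc =>
    singleWindow_lt_two_mul ha g (fun i => (hg i).1) (fun i => (hg i).2) hw hosc

/-! ## Finitely many window slices give the cutoff-bounded item -/

/-- **Cutoff reduction.** If the single-window body holds AT EVERY WINDOW `3 ≤ T < T₁` (every cutoff;
this is the shape delivered by `PWData.oscSingleWindowAt_of_checks`, slice by slice), then the route
body of `OscSingleWindow` — with its packaged window hypothesis `∃ T ≥ 3, …` — holds at every cutoff
`a` with `2a ≤ T₁`: unpack the window and use `T < 2a ≤ T₁` (`singleWindow_lt_two_mul`). [folklore] -/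
theorem oscSingleWindow_cutoff_of_slices (T₁ : ℝ)
    (hslices : ∀ T : ℝ, 3 ≤ T → T < T₁ →
      ∀ a : ℝ, 0 < a → ∀ (k : ℕ) (g : Fin k → ℝ → ℂ), (∀ i, (ContDiff ℝ ((⊤ : ℕ∞) : WithTop ℕ∞) (g i) ∧ HasCompactSupport (g i)) ∧ tsupport (g i) ⊆ Set.Icc (-a) a) → let F : ℝ → ℂ := fun t => ∑ i, MeasureTheory.convolution (g i) (fun u => (starRingEnd ℂ) ((g i) (-u))) (ContinuousLinearMap.mul ℂ ℂ) MeasureTheory.MeasureSpace.volume t; (∀ n : ℕ, 2 ≤ n → 0 ≤ (F (Real.log n)).re) → (∀ t : ℝ, Real.log 2 ≤ |t| → (F t).re < 0 → T ≤ |t| ∧ |t| ≤ T + Real.log 2) → (∃ t : ℝ, Real.log 2 ≤ |t| ∧ (F t).re < 0) → let M : ℂ → ℂ := fun s => ∫ u : ℝ, F u * Complex.exp ((s - 1 / 2) * u); -(F 0).re ≤ (M 0 + M 1 + ((1 / (2 * Real.pi) : ℂ) * (∫ t : ℝ, M (1 / 2 + t * Complex.I) * ((Complex.digamma (1 / 4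 + t / 2 * Complex.I)).re : ℂ)) - F 0 * (Real.log Real.pi : ℂ))).re) :
    ∀ a : ℝ, 0 < a → 2 * a ≤ T₁ → ∀ (k : ℕ) (g : Fin k → ℝ → ℂ), (∀ i, (ContDiff ℝ ((⊤ : ℕ∞) : WithTop ℕ∞) (g i) ∧ HasCompactSupport (g i)) ∧ tsupport (g i) ⊆ Set.Icc (-a) a) → let F : ℝ → ℂ := fun t => ∑ i, MeasureTheory.convolution (g i) (fun u => (starRingEnd ℂ) ((g i) (-u))) (ContinuousLinearMap.mul ℂ ℂ) MeasureTheory.MeasureSpace.volume t; (∀ n : ℕ, 2 ≤ n → 0 ≤ (F (Real.log n)).re) → (∃ T : ℝ, 3 ≤ T ∧ ∀ t : ℝ, Real.log 2 ≤ |t| → (F t).re < 0 → T ≤ |t| ∧ |t| ≤ T + Real.log 2) → (∃ t : ℝ, Real.log 2 ≤ |t| ∧ (F t).re < 0) → let M : ℂ → ℂ := fun s => ∫ u : ℝ, F u * Complex.exp ((s - 1 / 2) * u); -(F 0).re ≤ (M 0 + M 1 + ((1 / (2 * Real.pi) : ℂ) * (∫ t : ℝ, M (1 / 2 + t * Complex.I)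 * ((Complex.digamma (1 / 4 + t / 2 * Complex.I)).re : ℂ)) - F 0 * (Real.log Real.pi : ℂ))).re := by
  intro a ha haT k g hg F hn hw hosc
  obtain ⟨T, hT3, hwin⟩ := hw
  have hlt : T < 2 * a :=
    singleWindow_lt_two_mul ha g (fun i => (hg i).1) (fun i => (hg i).2) hwin hosc
  exact hslices T hT3 (by linarith) a ha k g hg hn hwin hosc

/-- **Cutoff reduction, `a ≤ a₁` form.** Slices `3 ≤ T < 2a₁` give the item restricted to cutoffs
`a ≤ a₁` (for `a₁ = 2`: windows `3 ≤ T < 4`; for `a₁ ≤ 3/2` the slice hypothesis is empty and the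
restricted item is vacuous, cf. `OscSingleWindow.Negative.oscSingleWindow_upTo_three_halves_vacuous`). [folklore] -/
theorem oscSingleWindow_upTo_of_slices (a₁ : ℝ)
    (hslices : ∀ T : ℝ, 3 ≤ T → T < 2 * a₁ →
      ∀ a : ℝ, 0 < a → ∀ (k : ℕ) (g : Fin k → ℝ → ℂ), (∀ i, (ContDiff ℝ ((⊤ : ℕ∞) : WithTop ℕ∞) (g i) ∧ HasCompactSupport (g i)) ∧ tsupport (g i) ⊆ Set.Icc (-a) a) → let F : ℝ → ℂ := fun t => ∑ i, MeasureTheory.convolution (g i) (fun u => (starRingEnd ℂ) ((g i) (-u))) (ContinuousLinearMap.mul ℂ ℂ) MeasureTheory.MeasureSpace.volume t; (∀ n : ℕ, 2 ≤ n → 0 ≤ (F (Real.log n)).re) → (∀ t : ℝ, Real.log 2 ≤ |t| → (F t).re < 0 → T ≤ |t| ∧ |t| ≤ T + Real.log 2) → (∃ t : ℝ, Real.log 2 ≤ |t| ∧ (F t).re < 0) → let M : ℂ → ℂ := fun s => ∫ u : ℝ, F u * Complex.exp ((s - 1 / 2) * u); -(F 0).re ≤ (M 0 + M 1 + ((1 /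 (2 * Real.pi) : ℂ) * (∫ t : ℝ, M (1 / 2 + t * Complex.I) * ((Complex.digamma (1 / 4 + t / 2 * Complex.I)).re : ℂ)) - F 0 * (Real.log Real.pi : ℂ))).re) :
    ∀ a : ℝ, 0 < a → a ≤ a₁ → ∀ (k : ℕ) (g : Fin k → ℝ → ℂ), (∀ i, (ContDiff ℝ ((⊤ : ℕ∞) : WithTop ℕ∞) (g i) ∧ HasCompactSupport (g i)) ∧ tsupport (g i) ⊆ Set.Icc (-a) a) → let F : ℝ → ℂ := fun t => ∑ i, MeasureTheory.convolution (g i) (fun u => (starRingEnd ℂ) ((g i) (-u))) (ContinuousLinearMap.mul ℂ ℂ) MeasureTheory.MeasureSpace.volume t; (∀ n : ℕ, 2 ≤ n → 0 ≤ (F (Real.log n)).re) → (∃ T : ℝ, 3 ≤ T ∧ ∀ t : ℝ, Real.log 2 ≤ |t| → (F t).re < 0 → T ≤ |t| ∧ |t| ≤ T + Real.log 2) → (∃ t : ℝ, Real.log 2 ≤ |t| ∧ (F t).re < 0) → let M : ℂ → ℂ := fun s => ∫ u : ℝ, F u * Complex.exp ((s - 1 / 2) * u); -(F 0).re ≤ (M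 0 + M 1 + ((1 / (2 * Real.pi) : ℂ) * (∫ t : ℝ, M (1 / 2 + t * Complex.I) * ((Complex.digamma (1 / 4 + t / 2 * Complex.I)).re : ℂ)) - F 0 * (Real.log Real.pi : ℂ))).re :=
  fun a ha hle => oscSingleWindow_cutoff_of_slices (2 * a₁) hslices a ha (by linarith)

/-! ## The item is exactly "the body at every window `T ≥ 3`" -/

/-- **All windows give the item** (the route decl BY NAME): unpack `∃ T ≥ 3, …`. [folklore] -/
theorem oscSingleWindow_of_forall_window
    (h : ∀ T : ℝ, 3 ≤ T →
      ∀ a : ℝ, 0 < a → ∀ (k : ℕ) (g : Fin k → ℝ → ℂ), (∀ i, (ContDiff ℝ ((⊤ : ℕ∞) : WithTop ℕ∞) (g i) ∧ HasCompactSupport (g i)) ∧ tsupport (g i) ⊆ Set.Icc (-a) a) → let F : ℝ → ℂ := fun t => ∑ i, MeasureTheory.convolution (g i) (fun u => (starRingEnd ℂ) ((g i) (-u))) (ContinuousLinearMap.mul ℂ ℂ) MeasureTheory.MeasureSpace.volume t; (∀ n : ℕ, 2 ≤ n → 0 ≤ (F (Real.log n)).re) → (∀ t : ℝ, Real.log 2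 ≤ |t| → (F t).re < 0 → T ≤ |t| ∧ |t| ≤ T + Real.log 2) → (∃ t : ℝ, Real.log 2 ≤ |t| ∧ (F t).re < 0) → let M : ℂ → ℂ := fun s => ∫ u : ℝ, F u * Complex.exp ((s - 1 / 2) * u); -(F 0).re ≤ (M 0 + M 1 + ((1 / (2 * Real.pi) : ℂ) * (∫ t : ℝ, M (1 / 2 + t * Complex.I) * ((Complex.digamma (1 / 4 + t / 2 * Complex.I)).re : ℂ)) - F 0 * (Real.log Real.pi : ℂ))).re) :
    OscSingleWindow := by
  intro a ha k g hg F hn hw hosc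
  obtain ⟨T, hT3, hwin⟩ := hw
  exact h T hT3 a ha k g hg hn hwin hosc

/-- Conversely the item gives the body at every window `T ≥ 3` (so the `T`-slices are the item
restricted in `T`, and `oscSingleWindow_of_forall_window` loses nothing). [folklore] -/
theorem forall_window_of_oscSingleWindow (h : OscSingleWindow) :
    ∀ T : ℝ, 3 ≤ T →
      ∀ a : ℝ, 0 < a → ∀ (k : ℕ) (g : Fin k → ℝ → ℂ), (∀ i, (ContDiff ℝ ((⊤ : ℕ∞) : WithTop ℕ∞) (g i) ∧ HasCompactSupport (g i)) ∧ tsupport (g i) ⊆ Set.Icc (-a) a) → let F : ℝ → ℂ := fun t => ∑ i, MeasureTheory.convolution (g i) (fun u => (starRingEnd ℂ) ((g i) (-u))) (ContinuousLinearMap.mul ℂ ℂ) MeasureTheory.MeasureSpace.volume t; (∀ n : ℕ, 2 ≤ n → 0 ≤ (F (Real.log n)).re) → (∀ t : ℝ, Real.log 2 ≤ |t| → (F t).re < 0 → T ≤ |t| ∧ |t| ≤ T + Real.log 2) → (∃ t : ℝ, Real.log 2 ≤ |t| ∧ (F t).re < 0) → let M : ℂ → ℂ := fun s => ∫ u : ℝ,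 F u * Complex.exp ((s - 1 / 2) * u); -(F 0).re ≤ (M 0 + M 1 + ((1 / (2 * Real.pi) : ℂ) * (∫ t : ℝ, M (1 / 2 + t * Complex.I) * ((Complex.digamma (1 / 4 + t / 2 * Complex.I)).re : ℂ)) - F 0 * (Real.log Real.pi : ℂ))).re :=
  fun T hT3 a ha k g hg hn hwin hosc => h a ha k g hg hn ⟨T, hT3, hwin⟩ hosc

/-- **The item splits at any height `T₁`**: slices below `T₁` plus the tail `T ≥ T₁` give the route decl
by name (the shape of the line skeleton `OscSingleWindow_of ← stub_slice + stub_tail`, for an arbitrary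
split point). [folklore] -/
theorem oscSingleWindow_of_slices_of_tail (T₁ : ℝ)
    (hslices : ∀ T : ℝ, 3 ≤ T → T < T₁ →
      ∀ a : ℝ, 0 < a → ∀ (k : ℕ) (g : Fin k → ℝ → ℂ), (∀ i, (ContDiff ℝ ((⊤ : ℕ∞) : WithTop ℕ∞) (g i) ∧ HasCompactSupport (g i)) ∧ tsupport (g i) ⊆ Set.Icc (-a) a) → let F : ℝ → ℂ := fun t => ∑ i, MeasureTheory.convolution (g i) (fun u => (starRingEnd ℂ) ((g i) (-u))) (ContinuousLinearMap.mul ℂ ℂ) MeasureTheory.MeasureSpace.volume t; (∀ n : ℕ, 2 ≤ n → 0 ≤ (F (Real.log n)).re) → (∀ t : ℝ, Real.log 2 ≤ |t| → (F t).re < 0 → T ≤ |t| ∧ |t| ≤ T + Real.log 2) → (∃ t : ℝ, Real.log 2 ≤ |t| ∧ (F t).re < 0) → let M : ℂ → ℂ := fun s => ∫ u : ℝ, F u * Complex.exp ((s - 1 / 2) * u); -(F 0).re ≤ (M 0 + M 1 + ((1 / (2 * Real.pi) : ℂ) * (∫ t : ℝ, M (1 / 2 + t * Complex.I) * ((Complex.digamma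 (1 / 4 + t / 2 * Complex.I)).re : ℂ)) - F 0 * (Real.log Real.pi : ℂ))).re)
    (htail : ∀ T : ℝ, T₁ ≤ T →
      ∀ a : ℝ, 0 < a → ∀ (k : ℕ) (g : Fin k → ℝ → ℂ), (∀ i, (ContDiff ℝ ((⊤ : ℕ∞) : WithTop ℕ∞) (g i) ∧ HasCompactSupport (g i)) ∧ tsupport (g i) ⊆ Set.Icc (-a) a) → let F : ℝ → ℂ := fun t => ∑ i, MeasureTheory.convolution (g i) (fun u => (starRingEnd ℂ) ((g i) (-u))) (ContinuousLinearMap.mul ℂ ℂ) MeasureTheory.MeasureSpace.volume t; (∀ n : ℕ, 2 ≤ n → 0 ≤ (F (Real.log n)).re) → (∀ t : ℝ, Real.log 2 ≤ |t| → (F t).re < 0 → T ≤ |t| ∧ |t| ≤ T + Real.log 2) → (∃ t : ℝ, Real.log 2 ≤ |t| ∧ (F t).re < 0) → let M : ℂ → ℂ := fun s => ∫ u : ℝ, F u * Complex.exp ((s - 1 / 2) * u); -(F 0).re ≤ (M 0 + M 1 + ((1 / (2 * Real.pi) : ℂ) * (∫ t : ℝ, M (1 / 2 + t * Complex.I) *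 ((Complex.digamma (1 / 4 + t / 2 * Complex.I)).re : ℂ)) - F 0 * (Real.log Real.pi : ℂ))).re) :
    OscSingleWindow := by
  refine oscSingleWindow_of_forall_window fun T hT3 => ?_
  rcases lt_or_ge T T₁ with hlt | hge
  · exact hslices T hT3 hlt
  · exact htail T hge

end Summit.RiemannHypothesis.RiemannHypothesis.Theorems.SignCone

end
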